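import Summits.CriticalPhenomena.CardyFormulaZ2.Theorems.CardySusyWardParafermionFamiliesToSLESixTouchLowerBoundB

/-!
# Touch lower bound on diagonal free walls (stub `stub_touchLowerBound`, reshape r2, of the line
# `exact-potential-schwarz-christoffel`, crux stmt-CriticalPhenomena-10814), C: the core and the discrete boundary
# near a flat diagonal wall

Helper file (deterministic geometry, part 2 of 2; setting of part B: the one-sided box under the diagonal line
`{a x + b y = c}`, `k` the last lattice level under the line):

* `near_of_adj`, `near_of_isCorner`, `box_of_near`: lattice bookkeeping around a site;
* `mem_meshDomain_of_core`: given the bulk of `Ω_δ` between the heights `c - 3wν/4` and `c - wν/4`, every site of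
  the CORE `{|δ column - t₀| ≤ 5wτ/8, c - 3wν/4 ≤ δ level, level ≤ k}` lies in `Ω_δ = meshDomain Ω δ` (climb two
  levels at a time, `mem_meshDomain_of_meshGraph_adj`); `adj_of_core`: lattice neighbours of the core are
  `Ω_δ`-adjacent;
* `not_mem_zdBoundary_of_core`: a core site of level `≤ k - 2` (margin `2δ`) is no boundary site of Dobrushin
  data on `(Ω, δ)` (its neighbours are `Ω_δ`-adjacent to it, its four faces inner); `mem_zdBoundary_of_level`: a
  core site of level `k - 1` IS one — a concave corner of the boundary staircase: the lattice edge to its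
  level-`k` neighbour is a side of the inner face below and of the NON-inner face above, whose top corner of level
  `k + 1` is no mesh vertex. Registered one-line ticket `stub_touch_wallC`.
-/

noncomputable section

namespace Summit.CriticalPhenomena.CardyFormulaZ2.Theorems.ParafermionFamiliesToSLESix.TouchLowerBound

open Set Metric Complex
open Literature.Probability.LatticeModels Literature.Probability.Percolation

variable {Ω : Set ℂ} {δ c t₀ wτ wν : ℝ} {a b k : ℤ}

/-! ## Lattice bookkeeping around a site -/

/-- A lattice neighbour changes level and column by at most one. [folklore] -/
theorem near_of_adj (ha : a = 1 ∨ a = -1) (hb : b = 1 ∨ b = -1) {v y : Site 2} (h : (zdGraph 2).Adj v y) :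
    |(a * y 0 + b * y 1) - (a * v 0 + b * v 1)| ≤ 1 ∧ |(a * y 0 - b * y 1) - (a * v 0 - b * v 1)| ≤ 1 := by
  obtain ⟨i, hi | hi⟩ := (zdGraph_adj_iff _ _).1 h
  · have h0 := congrFun hi 0
    have h1 := congrFun hi 1
    fin_cases i <;> simp at h0 h1 <;> rw [abs_le, abs_le] <;> rcases ha with rfl | rfl <;> rcases hb with rfl | rfl <;> omega
  · have h0 := congrFun hi 0
    have h1 := congrFun hi 1
    fin_cases i <;> simp at h0 h1 <;> rw [abs_le, abs_le] <;> rcases ha with rfl | rfl <;> rcases hb with rfl | rfl <;> omega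

/-- Two corners of a face differ in level and in column by at most two. [folklore] -/
theorem near_of_isCorner (ha : a = 1 ∨ a = -1) (hb : b = 1 ∨ b = -1) {v w f : Site 2} (hv : IsCorner v f)
    (hw : IsCorner w f) :
    |(a * w 0 + b * w 1) - (a * v 0 + b * v 1)| ≤ 2 ∧ |(a * w 0 - b * w 1) - (a * v 0 - b * v 1)| ≤ 2 := by
  have hv0 := hv 0
  have hv1 := hv 1
  have hw0 := hw 0
  have hw1 := hw 1
  rw [abs_le, abs_le]
  rcases ha with rfl | rfl <;> rcases hb with rfl | rfl <;> omega

/-- **From integer proximity to the real box**: a site within `m` levels and columns of a site with margins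
`m δ` inherits the box bounds. [folklore] -/
theorem box_of_near (hδ : 0 ≤ δ) {v y : Site 2} {m : ℕ} {T N : ℝ}
    (h : |(a * y 0 + b * y 1) - (a * v 0 + b * v 1)| ≤ m ∧ |(a * y 0 - b * y 1) - (a * v 0 - b * v 1)| ≤ m)
    (hτ : |δ * ((a * v 0 - b * v 1 : ℤ) : ℝ) - t₀| ≤ T - m * δ) (hν : N + m * δ ≤ δ * ((a * v 0 + b * v 1 : ℤ) : ℝ)) :
    |δ * ((a * y 0 - b * y 1 : ℤ) : ℝ) - t₀| ≤ T ∧ N ≤ δ * ((a * y 0 + b * y 1 : ℤ) : ℝ) := by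
  obtain ⟨h1, h2⟩ := h
  rw [abs_le] at h1 h2 hτ ⊢
  obtain ⟨h1l, h1r⟩ := h1
  obtain ⟨h2l, h2r⟩ := h2
  have e1 : ((a * v 0 + b * v 1 : ℤ) : ℝ) - m ≤ ((a * y 0 + b * y 1 : ℤ) : ℝ) := by exact_mod_cast (by omega : (a * v 0 + b * v 1) - (m : ℤ) ≤ a * y 0 + b * y 1)
  have e2 : ((a * y 0 - b * y 1 : ℤ) : ℝ) ≤ ((a * v 0 - b * v 1 : ℤ) : ℝ) + m := by exact_mod_cast (by omega : a * y 0 - b * y 1 ≤ (a * v 0 - b * v 1) + (m : ℤ))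
  have e3 : ((a * v 0 - b * v 1 : ℤ) : ℝ) - m ≤ ((a * y 0 - b * y 1 : ℤ) : ℝ) := by exact_mod_cast (by omega : (a * v 0 - b * v 1) - (m : ℤ) ≤ a * y 0 - b * y 1)
  refine ⟨⟨?_, ?_⟩, ?_⟩ <;> nlinarith

/-! ## The core lies in the discrete domain -/

/-- **The core lies in `Ω_δ`.** If the sites of the box between the heights `c - 3wν/4` and `c - wν/4` (columns
`|δ column - t₀| ≤ 3wτ/4`) belong to `meshDomain Ω δ` (the bulk), then so does every site of the core
`{|δ column - t₀| ≤ 5wτ/8, c - 3wν/4 ≤ δ level, level ≤ k}`: climb from the bulk two levels at a time along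
`v ↦ v + a e₀ ↦ v + a e₀ + b e₁` (mesh vertices, mesh-graph neighbours; `mem_meshDomain_of_meshGraph_adj`).
[folklore] -/
theorem mem_meshDomain_of_core (hΩ : IsOpen Ω) (ha : a = 1 ∨ a = -1) (hb : b = 1 ∨ b = -1) (hδ : 0 < δ)
    (hwτ : 0 < wτ) (hwν : 0 < wν)
    (hin : ∀ z : ℂ, |a * z.re - b * z.im - t₀| < wτ → c - wν < a * z.re + b * z.im → a * z.re + b * z.im < c → z ∈ Ω)
    (hout : ∀ z : ℂ, |a * z.re - b * z.im - t₀| < wτ → c < a * z.re + b * z.im → a * z.re + b * z.im < c + wν → z ∉ Ω)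
    (hk : δ * k < c) (hδτ : 8 * δ ≤ wτ) (hδν : 8 * δ ≤ wν)
    (hbulk : ∀ x : Site 2, |δ * ((a * x 0 - b * x 1 : ℤ) : ℝ) - t₀| ≤ 3 * wτ / 4 →
      c - 3 * wν / 4 ≤ δ * ((a * x 0 + b * x 1 : ℤ) : ℝ) → δ * ((a * x 0 + b * x 1 : ℤ) : ℝ) ≤ c - wν / 4 →
      x ∈ meshDomain Ω δ)
    (v : Site 2) (hτ : |δ * ((a * v 0 - b * v 1 : ℤ) : ℝ) - t₀| ≤ 5 * wτ / 8)
    (hν : c - 3 * wν / 4 ≤ δ * ((a * v 0 + b * v 1 : ℤ) : ℝ)) (hlev : a * v 0 + b * v 1 ≤ k) :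
    v ∈ meshDomain Ω δ := by
  have ha2 := sign_mul_self ha
  have hb2 := sign_mul_self hb
  -- the level of a core site is `< c`
  have hlevc : ∀ y : Site 2, a * y 0 + b * y 1 ≤ k → δ * ((a * y 0 + b * y 1 : ℤ) : ℝ) < c := fun y hy => by
    have : ((a * y 0 + b * y 1 : ℤ) : ℝ) ≤ k := by exact_mod_cast hy
    nlinarith
  suffices H : ∀ m : ℕ, ∀ v : Site 2, |δ * ((a * v 0 - b * v 1 : ℤ) : ℝ) - t₀| ≤ 5 * wτ / 8 →
      c - 3 * wν / 4 ≤ δ * ((a * v 0 + b * v 1 : ℤ) : ℝ) → a * v 0 + b * v 1 ≤ k →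
      δ * ((a * v 0 + b * v 1 : ℤ) : ℝ) ≤ c - wν / 4 + m * δ → v ∈ meshDomain Ω δ by
    obtain ⟨m, hm⟩ := exists_nat_ge (wν / (4 * δ))
    refine H m v hτ hν hlev ?_
    have h1 : wν / 4 ≤ m * δ := by
      rw [div_le_iff₀ (by positivity)] at hm
      linarith
    linarith [hlevc v hlev]
  intro m
  induction m with
  | zero =>
    intro v hτ hν hlev hm
    simp only [Nat.cast_zero, zero_mul, add_zero] at hm
    exact hbulk v (by linarith [abs_nonneg (δ * ((a * v 0 - b * v 1 : ℤ) : ℝ) - t₀), abs_le.1 hτ]) hν hm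
  | succ m ih =>
    intro v hτ hν hlev hm
    by_cases hcase : δ * ((a * v 0 + b * v 1 : ℤ) : ℝ) ≤ c - wν / 4 + m * δ
    · exact ih v hτ hν hlev hcase
    rw [not_le] at hcase
    have hMδ : ((m + 1 : ℕ) : ℝ) * δ = m * δ + δ := by push_cast; ring
    rw [hMδ] at hm
    have hm0 : (0:ℝ) ≤ m * δ := by positivity
    -- two levels down
    set w : Site 2 := v - Pi.single 0 a with hw_def
    set u : Site 2 := w - Pi.single 1 b with hu_def
    have hw0 : w 0 = v 0 - a := by simp [hw_def]
    have hw1 : w 1 = v 1 := by simp [hw_def]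
    have hu0 : u 0 = v 0 - a := by simp [hu_def, hw_def]
    have hu1 : u 1 = v 1 - b := by simp [hu_def, hw_def]
    have hlu : a * u 0 + b * u 1 = a * v 0 + b * v 1 - 2 := by rw [hu0, hu1, mul_sub, mul_sub, ha2, hb2]; ring
    have htu : a * u 0 - b * u 1 = a * v 0 - b * v 1 := by rw [hu0, hu1, mul_sub, mul_sub, ha2, hb2]; ring
    have hlw : a * w 0 + b * w 1 = a * v 0 + b * v 1 - 1 := by rw [hw0, hw1, mul_sub, ha2]; ring
    have htw : a * w 0 - b * w 1 = a * v 0 - b * v 1 - 1 := by rw [hw0, hw1, mul_sub, ha2]; ring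
    have eLu : δ * ((a * u 0 + b * u 1 : ℤ) : ℝ) = δ * ((a * v 0 + b * v 1 : ℤ) : ℝ) - 2 * δ := by
      rw [hlu]; push_cast; ring
    have eTu : δ * ((a * u 0 - b * u 1 : ℤ) : ℝ) = δ * ((a * v 0 - b * v 1 : ℤ) : ℝ) := by rw [htu]
    have eLw : δ * ((a * w 0 + b * w 1 : ℤ) : ℝ) = δ * ((a * v 0 + b * v 1 : ℤ) : ℝ) - δ := by
      rw [hlw]; push_cast; ring
    have eTw : δ * ((a * w 0 - b * w 1 : ℤ) : ℝ) = δ * ((a * v 0 - b * v 1 : ℤ) : ℝ) - δ := by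
      rw [htw]; push_cast; ring
    have hvc := hlevc v hlev
    obtain ⟨hτl, hτr⟩ := abs_le.1 hτ
    -- `u` is in `Ω_δ` by induction
    have hu : u ∈ meshDomain Ω δ := by
      refine ih u ?_ ?_ ?_ ?_
      · rw [eTu]; exact hτ
      · rw [eLu]; linarith
      · omega
      · rw [eLu]; linarith
    -- `w` and `v` are mesh vertices, and `u ∼ w ∼ v` in the mesh graph
    have hwV : w ∈ meshVertices Ω δ := by
      refine mem_meshVertices_of_level_le hδ hin hk w ?_ ?_ (by omega)
      · rw [eTw, abs_lt]; constructor <;> linarith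
      · rw [eLw]; linarith
    have hvV : v ∈ meshVertices Ω δ :=
      mem_meshVertices_of_level_le hδ hin hk v (abs_lt.2 ⟨by linarith, by linarith⟩) (by linarith) hlev
    have hadj₁ : (meshGraph Ω δ).Adj u w := by
      have hzd : (zdGraph 2).Adj u w := by
        have : w = u + Pi.single 1 b := (sub_add_cancel _ _).symm
        rw [this]; exact zdGraph_adj_add_single u 1 hb
      refine meshGraph_adj_of_mem_box hΩ ha hb hwτ hwν hin hout hzd ?_ ?_ ?_ ?_ ?_ ?_
      · rw [eTu, abs_le]; constructor <;> linarith
      · rw [eLu]; linarith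
      · rw [eLu]; linarith
      · rw [eTw, abs_le]; constructor <;> linarith
      · rw [eLw]; linarith
      · rw [eLw]; linarith
    have hw : w ∈ meshDomain Ω δ := mem_meshDomain_of_meshGraph_adj hu hwV hadj₁
    have hadj₂ : (meshGraph Ω δ).Adj w v := by
      have hzd : (zdGraph 2).Adj w v := by
        have : v = w + Pi.single 0 a := (sub_add_cancel _ _).symm
        rw [this]; exact zdGraph_adj_add_single w 0 ha
      refine meshGraph_adj_of_mem_box hΩ ha hb hwτ hwν hin hout hzd ?_ ?_ ?_ ?_ ?_ ?_
      · rw [eTw, abs_le]; constructor <;> linarith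
      · rw [eLw]; linarith
      · rw [eLw]; linarith
      · rw [abs_le]; constructor <;> linarith
      · linarith
      · exact hvc.le
    exact mem_meshDomain_of_meshGraph_adj hw hvV hadj₂

/-- **Lattice neighbours of the core are `Ω_δ`-adjacent.** [folklore] -/
theorem adj_of_core (hΩ : IsOpen Ω) (ha : a = 1 ∨ a = -1) (hb : b = 1 ∨ b = -1) (hδ : 0 < δ)
    (hwτ : 0 < wτ) (hwν : 0 < wν)
    (hin : ∀ z : ℂ, |a * z.re - b * z.im - t₀| < wτ → c - wν < a * z.re + b * z.im → a * z.re + b * z.im < c → z ∈ Ω)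
    (hout : ∀ z : ℂ, |a * z.re - b * z.im - t₀| < wτ → c < a * z.re + b * z.im → a * z.re + b * z.im < c + wν → z ∉ Ω)
    (hk : δ * k < c) (hδτ : 8 * δ ≤ wτ) (hδν : 8 * δ ≤ wν)
    (hbulk : ∀ x : Site 2, |δ * ((a * x 0 - b * x 1 : ℤ) : ℝ) - t₀| ≤ 3 * wτ / 4 →
      c - 3 * wν / 4 ≤ δ * ((a * x 0 + b * x 1 : ℤ) : ℝ) → δ * ((a * x 0 + b * x 1 : ℤ) : ℝ) ≤ c - wν / 4 →
      x ∈ meshDomain Ω δ)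
    {u w : Site 2} (huw : (zdGraph 2).Adj u w)
    (hu₁ : |δ * ((a * u 0 - b * u 1 : ℤ) : ℝ) - t₀| ≤ 5 * wτ / 8) (hu₂ : c - 3 * wν / 4 ≤ δ * ((a * u 0 + b * u 1 : ℤ) : ℝ))
    (hu₃ : a * u 0 + b * u 1 ≤ k)
    (hw₁ : |δ * ((a * w 0 - b * w 1 : ℤ) : ℝ) - t₀| ≤ 5 * wτ / 8) (hw₂ : c - 3 * wν / 4 ≤ δ * ((a * w 0 + b * w 1 : ℤ) : ℝ))
    (hw₃ : a * w 0 + b * w 1 ≤ k) : (discreteDomainGraph Ω δ).Adj u w := by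
  have hlevc : ∀ y : Site 2, a * y 0 + b * y 1 ≤ k → δ * ((a * y 0 + b * y 1 : ℤ) : ℝ) < c := fun y hy => by
    have : ((a * y 0 + b * y 1 : ℤ) : ℝ) ≤ k := by exact_mod_cast hy
    nlinarith
  refine discreteDomainGraph_adj_iff.2 ⟨?_, ?_, ?_⟩
  · refine meshGraph_adj_of_mem_box hΩ ha hb hwτ hwν hin hout huw ?_ (by linarith) (hlevc u hu₃).le ?_ (by linarith)
      (hlevc w hw₃).le
    · linarith [abs_nonneg (δ * ((a * u 0 - b * u 1 : ℤ) : ℝ) - t₀)]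
    · linarith [abs_nonneg (δ * ((a * w 0 - b * w 1 : ℤ) : ℝ) - t₀)]
  · exact mem_meshDomain_of_core hΩ ha hb hδ hwτ hwν hin hout hk hδτ hδν hbulk u hu₁ hu₂ hu₃
  · exact mem_meshDomain_of_core hΩ ha hb hδ hwτ hwν hin hout hk hδτ hδν hbulk w hw₁ hw₂ hw₃

/-! ## The discrete boundary near the wall -/

/-- **Core sites of level `≤ k - 2` are no boundary sites** (margin `2δ`): their lattice neighbours are
`Ω_δ`-adjacent to them and their four faces are inner. [folklore] -/
theorem not_mem_zdBoundary_of_core {E : DiscreteDobrushin} (hEΩ : E.Ω = Ω) (hEδ : E.δ = δ) (hΩ : IsOpen Ω)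
    (ha : a = 1 ∨ a = -1) (hb : b = 1 ∨ b = -1) (hδ : 0 < δ) (hwτ : 0 < wτ) (hwν : 0 < wν)
    (hin : ∀ z : ℂ, |a * z.re - b * z.im - t₀| < wτ → c - wν < a * z.re + b * z.im → a * z.re + b * z.im < c → z ∈ Ω)
    (hout : ∀ z : ℂ, |a * z.re - b * z.im - t₀| < wτ → c < a * z.re + b * z.im → a * z.re + b * z.im < c + wν → z ∉ Ω)
    (hk : δ * k < c) (hδτ : 8 * δ ≤ wτ) (hδν : 8 * δ ≤ wν)
    (hbulk : ∀ x : Site 2, |δ * ((a * x 0 - b * x 1 : ℤ) : ℝ) - t₀| ≤ 3 * wτ / 4 →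
      c - 3 * wν / 4 ≤ δ * ((a * x 0 + b * x 1 : ℤ) : ℝ) → δ * ((a * x 0 + b * x 1 : ℤ) : ℝ) ≤ c - wν / 4 →
      x ∈ meshDomain Ω δ)
    (v : Site 2) (hτ : |δ * ((a * v 0 - b * v 1 : ℤ) : ℝ) - t₀| ≤ 5 * wτ / 8 - 2 * δ)
    (hν : c - 3 * wν / 4 + 2 * δ ≤ δ * ((a * v 0 + b * v 1 : ℤ) : ℝ)) (hlev : a * v 0 + b * v 1 ≤ k - 2) :
    v ∉ E.zdBoundary := by
  have hadj := fun {u w : Site 2} => adj_of_core (u := u) (w := w) hΩ ha hb hδ hwτ hwν hin hout hk hδτ hδν hbulk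
  have hv2 := box_of_near (a := a) (b := b) (t₀ := t₀) (m := 2) (T := 5 * wτ / 8) (N := c - 3 * wν / 4) hδ.le
    (v := v) (y := v) ⟨by simp, by simp⟩ (by simp only [Nat.cast_ofNat]; linarith) (by simp only [Nat.cast_ofNat]; linarith)
  intro h
  rcases E.mem_zdBoundary_iff.1 h with hx | ⟨y, hfe⟩
  · rw [mem_meshBoundary_iff] at hx
    obtain ⟨-, y, hvy, hn⟩ := hx
    apply hn
    rw [hEΩ, hEδ]
    have hnear := near_of_adj ha hb hvy
    have hy := box_of_near (t₀ := t₀) (m := 1) (T := 5 * wτ / 8) (N := c - 3 * wν / 4) hδ.le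
      ⟨hnear.1.trans (by norm_num), hnear.2.trans (by norm_num)⟩
      (by simp only [Nat.cast_one, one_mul]; linarith) (by simp only [Nat.cast_one, one_mul]; linarith)
    have := (abs_le.1 hnear.1).2
    exact hadj hvy hv2.1 hv2.2 (by omega) hy.1 hy.2 (by omega)
  · obtain ⟨-, -, f, hf, hvf, -⟩ := hfe
    apply hf
    intro w w' hw hw' hww'
    rw [hEΩ, hEδ]
    have hnw := near_of_isCorner ha hb hvf hw
    have hnw' := near_of_isCorner ha hb hvf hw'
    have hbw := box_of_near (t₀ := t₀) (m := 2) (T := 5 * wτ / 8) (N := c - 3 * wν / 4) hδ.le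
      ⟨hnw.1.trans (by norm_num), hnw.2.trans (by norm_num)⟩ (by simp only [Nat.cast_ofNat]; linarith)
      (by simp only [Nat.cast_ofNat]; linarith)
    have hbw' := box_of_near (t₀ := t₀) (m := 2) (T := 5 * wτ / 8) (N := c - 3 * wν / 4) hδ.le
      ⟨hnw'.1.trans (by norm_num), hnw'.2.trans (by norm_num)⟩ (by simp only [Nat.cast_ofNat]; linarith)
      (by simp only [Nat.cast_ofNat]; linarith)
    have := (abs_le.1 hnw.1).2
    have := (abs_le.1 hnw'.1).2
    exact hadj hww' hbw.1 hbw.2 (by omega) hbw'.1 hbw'.2 (by omega)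

/-- **Core sites of level `k - 1` are boundary sites**: the lattice edge to the level-`k` neighbour `y + a e₀`
is a side of the inner face below it and of the NON-inner face above it (whose top corner, of level `k + 1`, is
no mesh vertex) — a concave corner of the boundary staircase. [folklore] -/
theorem mem_zdBoundary_of_level {E : DiscreteDobrushin} (hEΩ : E.Ω = Ω) (hEδ : E.δ = δ) (hΩ : IsOpen Ω)
    (ha : a = 1 ∨ a = -1) (hb : b = 1 ∨ b = -1) (hδ : 0 < δ) (hwτ : 0 < wτ) (hwν : 0 < wν)
    (hin : ∀ z : ℂ, |a * z.re - b * z.im - t₀| < wτ → c - wν < a * z.re + b * z.im → a * z.re + b * z.im < c → z ∈ Ω)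
    (hout : ∀ z : ℂ, |a * z.re - b * z.im - t₀| < wτ → c < a * z.re + b * z.im → a * z.re + b * z.im < c + wν → z ∉ Ω)
    (hk : δ * k < c) (hk' : c ≤ δ * (k + 1)) (hδτ : 8 * δ ≤ wτ) (hδν : 8 * δ ≤ wν)
    (hbulk : ∀ x : Site 2, |δ * ((a * x 0 - b * x 1 : ℤ) : ℝ) - t₀| ≤ 3 * wτ / 4 →
      c - 3 * wν / 4 ≤ δ * ((a * x 0 + b * x 1 : ℤ) : ℝ) → δ * ((a * x 0 + b * x 1 : ℤ) : ℝ) ≤ c - wν / 4 →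
      x ∈ meshDomain Ω δ)
    (y : Site 2) (hτ : |δ * ((a * y 0 - b * y 1 : ℤ) : ℝ) - t₀| ≤ 5 * wτ / 8 - 2 * δ) (hlev : a * y 0 + b * y 1 = k - 1) :
    y ∈ E.zdBoundary := by
  have ha2 := sign_mul_self ha
  have hb2 := sign_mul_self hb
  have hadj := fun {u w : Site 2} => adj_of_core (u := u) (w := w) hΩ ha hb hδ hwτ hwν hin hout hk hδτ hδν hbulk
  -- `IsCorner` in the two coordinates
  have isCorner_iff_coord : ∀ v f : Site 2, IsCorner v f ↔ (v 0 = f 0 ∨ v 0 = f 0 + 1) ∧ (v 1 = f 1 ∨ v 1 = f 1 + 1) :=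
    fun v f => ⟨fun h => ⟨h 0, h 1⟩, fun h i => by fin_cases i; exacts [h.1, h.2]⟩
  -- the level of `y` in real terms
  have hyl : δ * ((a * y 0 + b * y 1 : ℤ) : ℝ) = δ * k - δ := by rw [hlev]; push_cast; ring
  have hν : c - 3 * wν / 4 + 2 * δ ≤ δ * ((a * y 0 + b * y 1 : ℤ) : ℝ) := by rw [hyl]; nlinarith
  -- every site within two steps of `y` and of level `≤ k` is a core site
  have hcore : ∀ w : Site 2, |(a * w 0 + b * w 1) - (a * y 0 + b * y 1)| ≤ 2 → |(a * w 0 - b * w 1) - (a * y 0 - b * y 1)| ≤ 2 →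
      |δ * ((a * w 0 - b * w 1 : ℤ) : ℝ) - t₀| ≤ 5 * wτ / 8 ∧ c - 3 * wν / 4 ≤ δ * ((a * w 0 + b * w 1 : ℤ) : ℝ) :=
    fun w h1 h2 => box_of_near (t₀ := t₀) (m := 2) (T := 5 * wτ / 8) (N := c - 3 * wν / 4) hδ.le ⟨h1, h2⟩
      (by simp only [Nat.cast_ofNat]; linarith) (by simp only [Nat.cast_ofNat]; linarith)
  -- the two faces and the neighbour
  set y' : Site 2 := y + Pi.single 0 a with hy'_def
  set z : Site 2 := y + Pi.single 0 a + Pi.single 1 b with hz_def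
  have hy'0 : y' 0 = y 0 + a := by simp [hy'_def]
  have hy'1 : y' 1 = y 1 := by simp [hy'_def]
  have hz0 : z 0 = y 0 + a := by simp [hz_def]
  have hz1 : z 1 = y 1 + b := by simp [hz_def]
  set f₁ : Site 2 := ![y 0 + (a - 1) / 2, y 1 - (b + 1) / 2] with hf₁
  set f₂ : Site 2 := ![y 0 + (a - 1) / 2, y 1 + (b - 1) / 2] with hf₂
  have f₁0 : f₁ 0 = y 0 + (a - 1) / 2 := by simp [hf₁]
  have f₁1 : f₁ 1 = y 1 - (b + 1) / 2 := by simp [hf₁]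
  have f₂0 : f₂ 0 = y 0 + (a - 1) / 2 := by simp [hf₂]
  have f₂1 : f₂ 1 = y 1 + (b - 1) / 2 := by simp [hf₂]
  have hcy₁ : IsCorner y f₁ := by
    rw [isCorner_iff_coord, f₁0, f₁1]; rcases ha with rfl | rfl <;> rcases hb with rfl | rfl <;> omega
  have hcy'₁ : IsCorner y' f₁ := by
    rw [isCorner_iff_coord, f₁0, f₁1, hy'0, hy'1]; rcases ha with rfl | rfl <;> rcases hb with rfl | rfl <;> omega
  have hcy₂ : IsCorner y f₂ := by
    rw [isCorner_iff_coord, f₂0, f₂1]; rcases ha with rfl | rfl <;> rcases hb with rfl | rfl <;> omega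
  have hcy'₂ : IsCorner y' f₂ := by
    rw [isCorner_iff_coord, f₂0, f₂1, hy'0, hy'1]; rcases ha with rfl | rfl <;> rcases hb with rfl | rfl <;> omega
  have hcz₂ : IsCorner z f₂ := by
    rw [isCorner_iff_coord, f₂0, f₂1, hz0, hz1]; rcases ha with rfl | rfl <;> rcases hb with rfl | rfl <;> omega
  -- levels of the corners of `f₁`
  have hcorner₁ : ∀ w : Site 2, IsCorner w f₁ → a * w 0 + b * w 1 ≤ k ∧
      |(a * w 0 + b * w 1) - (a * y 0 + b * y 1)| ≤ 2 ∧ |(a * w 0 - b * w 1) - (a * y 0 - b * y 1)| ≤ 2 := by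
    intro w hw
    rw [isCorner_iff_coord, f₁0, f₁1] at hw
    obtain ⟨hw0, hw1⟩ := hw
    rw [abs_le, abs_le]
    rcases ha with rfl | rfl <;> rcases hb with rfl | rfl <;> omega
  refine E.mem_zdBoundary_iff.2 (Or.inr ⟨y', ?_, ⟨f₁, ?_, hcy₁, hcy'₁⟩, ⟨f₂, ?_, hcy₂, hcy'₂⟩⟩)
  · -- the edge `y ∼ y'` is an edge of `Ω_δ`
    rw [hEΩ, hEδ]
    have hl' : a * y' 0 + b * y' 1 = a * y 0 + b * y 1 + 1 := by rw [hy'0, hy'1, mul_add, ha2]; ring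
    have ht' : a * y' 0 - b * y' 1 = a * y 0 - b * y 1 + 1 := by rw [hy'0, hy'1, mul_add, ha2]; ring
    have hc := hcore y' (by rw [hl']; simp) (by rw [ht']; simp)
    have hcy := hcore y (by simp) (by simp)
    exact hadj (by rw [hy'_def]; exact zdGraph_adj_add_single y 0 ha) hcy.1 hcy.2 (by omega) hc.1 hc.2 (by omega)
  · -- the face `f₁` below is inner
    intro w w' hw hw' hww'
    rw [hEΩ, hEδ]
    obtain ⟨hwk, hw1, hw2⟩ := hcorner₁ w hw
    obtain ⟨hwk', hw1', hw2'⟩ := hcorner₁ w' hw'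
    have hc := hcore w hw1 hw2
    have hc' := hcore w' hw1' hw2'
    exact hadj hww' hc.1 hc.2 hwk hc'.1 hc'.2 hwk'
  · -- the face `f₂` above is not inner: its corner `z` of level `k + 1` is no mesh vertex
    intro hf
    have hzy' : (zdGraph 2).Adj y' z := by rw [hz_def, hy'_def]; exact zdGraph_adj_add_single _ 1 hb
    have hzdom := (discreteDomainGraph_adj_iff.1 (hf y' z hcy'₂ hcz₂ hzy')).2.2
    rw [hEΩ, hEδ] at hzdom
    refine not_mem_meshVertices_of_lt_level hΩ ha hb hδ hwν hout hk' z ?_ ?_ ?_ (meshDomain_subset_meshVertices _ _ hzdom)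
    · have htz : a * z 0 - b * z 1 = a * y 0 - b * y 1 := by rw [hz0, hz1, mul_add, mul_add, ha2, hb2]; ring
      rw [htz, abs_lt]
      obtain ⟨h1, h2⟩ := abs_le.1 hτ
      constructor <;> linarith
    · have hlz : a * z 0 + b * z 1 = a * y 0 + b * y 1 + 2 := by rw [hz0, hz1, mul_add, mul_add, ha2, hb2]; ring
      have : δ * ((a * z 0 + b * z 1 : ℤ) : ℝ) = δ * k + δ := by rw [hlz, hlev]; push_cast; ring
      rw [this]; linarith
    · rw [hz0, hz1, mul_add, mul_add, ha2, hb2]; omega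

/-- **Registered one-line ticket `stub_touch_wallC`** (helper C of `stub_touchLowerBound`): a lattice neighbour
changes diagonal level and column by at most one. [folklore] -/
theorem stub_touch_wallC : ∀ (a b : ℤ), (a = 1 ∨ a = -1) → (b = 1 ∨ b = -1) → ∀ (v y : Site 2), (zdGraph 2).Adj v y → |(a * y 0 + b * y 1) - (a * v 0 + b * v 1)| ≤ 1 ∧ |(a * y 0 - b * y 1) - (a * v 0 - b * v 1)| ≤ 1 :=
  fun _ _ ha hb _ _ h => near_of_adj ha hb h

end Summit.CriticalPhenomena.CardyFormulaZ2.Theorems.ParafermionFamiliesToSLESix.TouchLowerBound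

end
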